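import Literature.AlgebraicGeometry.GroupSchemes.BarsottiTateGroupFixedPartBaseChange
import Literature.AlgebraicGeometry.GroupSchemes.IsIsoOrEtaleOfNatCard
import Literature.AlgebraicGeometry.AbelianSchemes.AbelianSchemeOverMulNEtale
import Literature.AlgebraicGeometry.AbelianSchemes.PDivisibleGroupOfAbelianScheme
import HarnessLib

/-!
# The rank of the fixed part of an idempotent on a Barsotti–Tate group from a POINT COUNT at a geometric point
# (Tate, *p-divisible groups* §2 (2.1), (2.4); Messing, LNM 264, Ch. I (1.1)–(1.6))

Layer `Literature/AlgebraicGeometry/GroupSchemes`, namespace `Literature.AlgebraicGeometry.GroupSchemes` (+ `BTGroup`, `BTGroup.Hom`).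
Cell `hodgecm-mathlib` (D-0151), FLOOR 0, P6 «MOD programme», DEAL 5 (S-H-BT) «block height from the generic fibre» FILE A
(socket (S-H) `hrank` of the K∕BT cut, F0P6d-plan (g2) KBT-CUT v2.3 §1); `--supports stmt-HodgeConjecture-24832`; COUNT-NEUTRAL —
HC_CM is proved only modulo the 2 remaining named inputs (hLiu418 24832, h413 24833) until rung 0 closes; this file discharges
none of them.  THEOREMS ONLY (no definition, no instance, no named fact, no `sorry`).

For a Barsotti–Tate group `B₀` over a LOCAL base `Spec R₀` and an idempotent endomorphism `ε₀` (★ `BarsottiTateGroupFixedPart`: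
the fixed part `Fix ε₀ = (Ker(𝟙 ∕ ε₀,ₙ))ₙ`, layers `fixLayer n`, finite and flat), the RANK HYPOTHESIS
`hrank : ∀ n s, rk_s (Fix ε₀)_n = p ^ (n h₀)` — the one input under which ★ `fixedPart` makes `Fix ε₀` a Barsotti–Tate group of
height `h₀` — is read off ONE geometric point `gΩ : Spec Ω → Spec R₀` (`Ω = Ω̄`, typically a geometric GENERIC point, where
`p ≠ 0`): there the layers `(Fix ε₀)_n ×_{R₀} Ω` are finite ÉTALE, so their rank is the NUMBER OF `Ω`-POINTS
(★ `natCard_hom_eq_finrank_of_etale`, [StacksProject, Tag 00U3]), i.e. the number of `ε₀`-FIXED `Ω`-points of the layer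
`G_n` (universal property of `Fix`); and the rank of the finite flat `(Fix ε₀)_n → Spec R₀` is constant on the local base
(★ `hrank_of_baseChange_point`, [Matsumura1987, Thm. 7.10]).  When `B₀ = A[p^∞]` comes from an abelian scheme
(socket ★ `BTGroup.IsOfAbelianScheme`, stable under base change ★ `IsOfAbelianScheme.baseChange`) and `(p : Ω) ≠ 0`, the
étaleness is automatic: `A_Ω[pⁿ] → Spec Ω` is étale ([GortzWedhorn2023, Prop. 27.188 (1)], ★ `etale_pow_id_left`) and a closed
subscheme of an étale scheme over a field is étale.
* §1 `etale_hom_of_isClosedImmersion_of_etale` — over a field, a closed subscheme of an étale scheme is étale;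
  `BTGroup.IsOfAbelianScheme.etale_hom` — the layers of `B = A[p^∞]` over a field with `(p : K) ≠ 0` are étale;
  `BTGroup.Hom.etale_fixLayer_hom_of_etale`, **`etale_fixLayer_baseChange_of_isOfAbelianScheme`** — so are the fixed layers of
  any endomorphism, after base change to any field-valued point `s : Spec K → S` with `(p : K) ≠ 0`.
* §2 `finrank_fixLayer_eq_natCard_points_of_etale` (rank = number of `Ω`-points for an étale fixed layer over `Ω = Ω̄`),
  **`hrank_of_natCard_points_of_etale`** — `hrank` on a local base from étaleness + a point count at a geometric point.
* §3 `natCard_points_fixLayer_eq`, `natCard_points_fixLayer_baseChange_eq` — the points of `(Fix ε)_n` with values in any `T`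
  are the `ε_n`-fixed `T`-points of `G_n` (the currency in which the count is computed).
* §4 **`hrank_of_natCard_fixedPoints_of_isOfAbelianScheme`**, **`hrank_pDivisibleGroup_of_natCard_fixedPoints`** — the
  assembled socket: for `B₀ = A[p^∞]` over a local `R₀`, an idempotent `ε₀`, and a geometric point `gΩ` with `(p : Ω) ≠ 0`,
  `#{x ∈ A[pⁿ](Ω) | x ∘ ε₀,ₙ = x} = p^{n h₀}` for all `n` ⇒ `hrank` with height `h₀` on `Spec R₀`.

## References
* [Tate1967] J. T. Tate, *p-divisible groups* (Driebergen 1966), Springer 1967 — §2 (2.1), (2.4).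
* [Messing1972] W. Messing, *The Crystals Associated to Barsotti–Tate Groups*, LNM 264 (1972) — Ch. I (1.1)–(1.6).
* [GortzWedhorn2023] U. Görtz, T. Wedhorn, *Algebraic Geometry II* (2023) — Prop. 27.187, Prop. 27.188 (1), Cor. 27.63.
* [GortzWedhorn2020] U. Görtz, T. Wedhorn, *Algebraic Geometry I*, 2nd ed. (2020) — Definition 4.45 (2) p. 117, Section (4.7).
* [StacksProject] The Stacks Project — Tags 00U3, 02GN, 02KA.
* [Tate1997FiniteFlatGroupSchemes] J. Tate, *Finite flat group schemes* (1997) — (3.7).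
* [Matsumura1987] H. Matsumura, *Commutative Ring Theory* — Thm. 7.10.
-/

noncomputable section

-- `fix φ = ker (𝟙 ∕ φ)`, `(B.baseChange g).G n = (Over.pullback g).obj (B.G n)`, `(F.baseChange g).app n = (Over.pullback g).map _`
-- are definitional only above `instances` transparency (as in ★ `BarsottiTateGroupFixedPartBaseChange`).
set_option backward.isDefEq.respectTransparency false

universe u

open CategoryTheory CategoryTheory.Limits AlgebraicGeometry MonoidalCategory CartesianMonoidalCategory
open scoped MonObj CategoryTheory.Obj

namespace Literature.AlgebraicGeometry.GroupSchemes

open Literature.AlgebraicGeometry.AbelianSchemes (AbelianSchemeOver)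

/-! ## §1 Étaleness of the fixed layers over a field in which `p ≠ 0` -/

/-- **Over a field, a closed subscheme of an étale scheme is étale**: for `K`-schemes `Z`, `G` and a `K`-morphism `i : Z → G`
which is a closed immersion, `G → Spec K` étale ⇒ `Z → Spec K` étale (`Z → Spec K = i ≫ (G → Spec K)` is formally unramified as a
composite of formally unramified morphisms, flat — everything is flat over a field — and locally of finite presentation).
[cite: StacksProject, Tag 02GN] [cite: GortzWedhorn2023, Cor. 27.63] -/
theorem etale_hom_of_isClosedImmersion_of_etale {K : Type u} [Field K] {Z G : Over (Spec (.of K))} (i : Z ⟶ G)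
    [IsClosedImmersion i.left] [Etale G.hom] : Etale Z.hom := by
  haveI : FormallyUnramified G.hom := (Etale.iff_flat_and_formallyUnramified.mp inferInstance).2.1
  haveI : FormallyUnramified Z.hom := by
    rw [← Over.w i]
    exact MorphismProperty.comp_mem @FormallyUnramified i.left G.hom inferInstance inferInstance
  haveI : Flat Z.hom := flat_hom_of_field' Z
  haveI : LocallyOfFiniteType G.hom := inferInstance
  haveI : LocallyOfFiniteType Z.hom := by rw [← Over.w i]; infer_instance
  haveI : LocallyOfFinitePresentation Z.hom := LocallyOfFinitePresentation.iff_locallyOfFiniteType.mpr inferInstance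
  exact Etale.of_formallyUnramified_of_flat _

/-- In a field `K` with `(N : K) ≠ 0`, `N ≠ 0` in every residue field of `Spec K` (which receives `K`). [folklore] -/
private theorem natCast_residueField_ne_zero {K : Type u} [Field K] {N : ℕ} (hN : (N : K) ≠ 0) (s : ↥(Spec (.of K))) :
    (N : (Spec (.of K)).residueField s) ≠ 0 := by
  let φ : K →+* (Spec (.of K)).residueField s := (Spec.preimage ((Spec (.of K)).fromSpecResidueField s)).hom
  rw [← map_natCast φ N]
  exact (map_ne_zero φ).mpr hN

namespace BTGroup

variable {p h : ℕ}

/-- **The layers of `A[p^∞]` over a field with `p ≠ 0` are ÉTALE**: if `B = A[p^∞]` for an abelian scheme `A` over `Spec K`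
(socket ★ `IsOfAbelianScheme`: `B_n = Ker [pⁿ]_A` by a cartesian square on the unit section) and `(p : K) ≠ 0`, then every
`B_n → Spec K` is étale — the base change of the étale `[pⁿ]_A` ([GortzWedhorn2023] Prop. 27.187, ★ `etale_pow_id_left`) along the
unit section. [cite: GortzWedhorn2023, Prop. 27.188 (1)] [cite: Tate1967, §2 (2.1)] -/
theorem IsOfAbelianScheme.etale_hom {K : Type u} [Field K] {A : AbelianSchemeOver (Spec (.of K))}
    {B : BTGroup (Spec (.of K)) p h} (hB : B.IsOfAbelianScheme A) (hpK : (p : K) ≠ 0) (n : ℕ) : Etale (B.hom n) := by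
  obtain ⟨i, -, hsq, -⟩ := hB
  have hN : ∀ s : ↥(Spec (.of K)), ((p ^ n : ℕ) : (Spec (.of K)).residueField s) ≠ 0 := fun s =>
    natCast_residueField_ne_zero (K := K) (by rw [Nat.cast_pow]; exact pow_ne_zero n hpK) s
  have het : Etale ((((𝟙 A.X : A.X ⟶ A.X) ^ (p ^ n)) : A.X ⟶ A.X).left) := A.etale_pow_id_left hN
  have sq : IsPullback (i n).left (B.G n).hom ((((𝟙 A.X : A.X ⟶ A.X) ^ (p ^ n)) : A.X ⟶ A.X).left)
      (η[A.X] : 𝟙_ (Over (Spec (.of K))) ⟶ A.X).left := by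
    have h := (hsq n).map (Over.forget _)
    rwa [Over.forget_map, Over.forget_map, Over.forget_map, Over.forget_map, Over.toUnit_left] at h
  exact MorphismProperty.of_isPullback (P := @Etale) sq het

namespace Hom

variable {S : Scheme.{u}} {B : BTGroup S p h}

/-- **The fixed layers of an endomorphism of a Barsotti–Tate group with étale layers over a field are étale**
(`(Fix ε)_n ↪ G_n` is a closed immersion, ★ `isClosedImmersion_fixLayerι_left`; `etale_hom_of_isClosedImmersion_of_etale`).
[cite: Tate1967, §2 (2.1)] [cite: GortzWedhorn2023, Cor. 27.63] -/
theorem etale_fixLayer_hom_of_etale {K : Type u} [Field K] {B : BTGroup (Spec (.of K)) p h} (ε : Hom B B) (n : ℕ)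
    (hB : Etale (B.hom n)) : Etale (ε.fixLayer n).hom := by
  haveI := ε.isClosedImmersion_fixLayerι_left n
  haveI : Etale (B.G n).hom := hB
  exact etale_hom_of_isClosedImmersion_of_etale (ε.fixLayerι n)

/-- **The fixed layers of an endomorphism of `A[p^∞]`, base-changed to a field-valued point `s : Spec K → S` with `(p : K) ≠ 0`,
are ÉTALE over `K`** (`B ×_S K = (A ×_S K)[p^∞]`, ★ `IsOfAbelianScheme.baseChange`; `IsOfAbelianScheme.etale_hom`;
`etale_fixLayer_hom_of_etale`). [cite: GortzWedhorn2023, Prop. 27.188 (1)] [cite: Messing1972, Ch. I (1.1)–(1.6)] -/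
theorem etale_fixLayer_baseChange_of_isOfAbelianScheme {A : AbelianSchemeOver S} (hB : B.IsOfAbelianScheme A) (ε : Hom B B)
    {K : Type u} [Field K] (s : Spec (.of K) ⟶ S) (hpK : (p : K) ≠ 0) (n : ℕ) :
    Etale ((ε.baseChange s).fixLayer n).hom :=
  etale_fixLayer_hom_of_etale (ε.baseChange s) n ((hB.baseChange s).etale_hom hpK n)

/-! ## §2 `hrank` on a local base from a point count at a geometric point -/

/-- **Rank = number of points for an ÉTALE fixed layer over an algebraically closed field**: if `(Fix ε)_n → Spec K` is étale
and `K = K̄`, its rank at the point of `Spec K` is `#(Fix ε)_n(K)` (★ `hom_finrank_eq_finrank_alg`: rank = `dim_K Γ`; ★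
`natCard_hom_eq_finrank_of_etale`: `#G(K) = dim_K Γ` for finite étale `G` over `K = K̄`). [cite: StacksProject, Tag 00U3]
[cite: Tate1997FiniteFlatGroupSchemes, (3.7)] -/
theorem finrank_fixLayer_eq_natCard_points_of_etale {K : Type u} [Field K] [IsAlgClosed K] {B : BTGroup (Spec (.of K)) p h}
    (ε : Hom B B) (n : ℕ) (het : Etale (ε.fixLayer n).hom) (s : ↥(Spec (.of K))) :
    (ε.fixLayer n).hom.finrank s = Nat.card (𝟙_ (Over (Spec (.of K))) ⟶ ε.fixLayer n) := by
  haveI := ε.isFinite_fixLayer_hom n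
  haveI := het
  rw [hom_finrank_eq_finrank_alg (ε.fixLayer n) s, natCard_hom_eq_finrank_of_etale (ε.fixLayer n)]
  rfl

/-- **`hrank` ON A LOCAL BASE FROM A POINT COUNT AT A GEOMETRIC POINT.**  `B₀` a Barsotti–Tate group over a local `Spec R₀`,
`ε₀` an idempotent endomorphism, `gΩ : Spec Ω → Spec R₀` a point with `Ω = Ω̄` at which the fixed layers `(Fix ε₀)_n ×_{R₀} Ω`
are étale and have exactly `p^{n h₀}` points with values in `Ω`: then `rk_s (Fix ε₀)_n = p^{n h₀}` at EVERY `s ∈ Spec R₀`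
(`finrank_fixLayer_eq_natCard_points_of_etale` at `gΩ`; the rank of the finite flat `(Fix ε₀)_n` is constant on the local base and
base-changes, ★ `hrank_of_baseChange_point`).  This is the hypothesis `hrank` of ★ `fixedPart ε₀ hε₀ hrank : BTGroup (Spec R₀) p h₀`.
[cite: Tate1967, §2 (2.1) and (2.4)] [cite: Matsumura1987, Thm. 7.10] [cite: StacksProject, Tag 02KA] -/
theorem hrank_of_natCard_points_of_etale {R₀ : Type u} [CommRing R₀] [IsLocalRing R₀] {B₀ : BTGroup (Spec (.of R₀)) p h}
    (ε₀ : Hom B₀ B₀) (hε₀ : ∀ n, ε₀.app n ≫ ε₀.app n = ε₀.app n) {Ω : Type u} [Field Ω] [IsAlgClosed Ω]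
    (gΩ : Spec (.of Ω) ⟶ Spec (.of R₀)) {h₀ : ℕ} (het : ∀ n, Etale ((ε₀.baseChange gΩ).fixLayer n).hom)
    (hcount : ∀ n, Nat.card (𝟙_ (Over (Spec (.of Ω))) ⟶ (ε₀.baseChange gΩ).fixLayer n) = p ^ (n * h₀))
    (n : ℕ) (s : ↥(Spec (.of R₀))) : (ε₀.fixLayer n).hom.finrank s = p ^ (n * h₀) :=
  hrank_of_baseChange_point ε₀ hε₀ gΩ (IsLocalRing.closedPoint Ω) (fun m => by
    rw [finrank_fixLayer_eq_natCard_points_of_etale (ε₀.baseChange gΩ) m (het m), hcount m]) n s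

/-! ## §3 The currency of the count: points of `(Fix ε)_n` = `ε_n`-fixed points of `G_n` -/

/-- **The `T`-valued points of `(Fix ε)_n` are the `ε_n`-fixed `T`-valued points of `G_n`** (universal property of
`Fix = Ker(𝟙 ∕ ε_n)`: ★ `IdempotentSplitting.fixLift ∕ fixLift_ι ∕ mono_fixι`), as an equality of cardinalities.
[cite: GortzWedhorn2020, Definition 4.45 (2), p. 117] [cite: Tate1967, §2 (2.1)] -/
theorem natCard_points_fixLayer_eq (ε : Hom B B) (n : ℕ) (T : Over S) :
    Nat.card (T ⟶ ε.fixLayer n) = Nat.card {t : T ⟶ B.G n // t ≫ ε.app n = t} := by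
  letI := B.grpObj n
  haveI := ε.mono_fixLayerι n
  refine Nat.card_congr
    { toFun := fun x => ⟨x ≫ ε.fixLayerι n, by rw [Category.assoc, ε.fixLayerι_comp]⟩
      invFun := fun t => IdempotentSplitting.fixLift (ε.app n) t.1 t.2
      left_inv := fun x => ?_
      right_inv := fun t => Subtype.ext (IdempotentSplitting.fixLift_ι (ε.app n) _ _) }
  rw [← cancel_mono (ε.fixLayerι n)]
  exact IdempotentSplitting.fixLift_ι (ε.app n) _ _

/-- The same after base change along `g : S′ → S`: the `T`-valued points of `(Fix (ε ×_S S′))_n` are the `T`-valued points `t` of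
`G_n ×_S S′` with `t ≫ (ε_n ×_S S′) = t`. [cite: Messing1972, Ch. I (1.1)–(1.6)] [cite: GortzWedhorn2020, Definition 4.45 (2), p. 117] -/
theorem natCard_points_fixLayer_baseChange_eq {S' : Scheme.{u}} (g : S' ⟶ S) (ε : Hom B B) (n : ℕ) (T : Over S') :
    Nat.card (T ⟶ (ε.baseChange g).fixLayer n) =
      Nat.card {t : T ⟶ (Over.pullback g).obj (B.G n) // t ≫ (Over.pullback g).map (ε.app n) = t} :=
  natCard_points_fixLayer_eq (ε.baseChange g) n T

/-! ## §4 The assembled socket for `B₀ = A[p^∞]` -/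

/-- **BLOCK HEIGHT FROM THE GENERIC FIBRE (socket form).**  `A` an abelian scheme over a local `Spec R₀`, `B₀ = A[p^∞]`
(★ `IsOfAbelianScheme`), `ε₀` an idempotent endomorphism of `B₀`, `gΩ : Spec Ω → Spec R₀` a point with `Ω = Ω̄` and `(p : Ω) ≠ 0`
(e.g. a geometric generic point in characteristic `0`).  If for every `n` the number of `Ω`-points `x` of `A[pⁿ] ×_{R₀} Ω` with
`x ≫ (ε₀,ₙ ×_{R₀} Ω) = x` is `p^{n h₀}`, then `rk_s (Fix ε₀)_n = p^{n h₀}` for all `n` and all `s ∈ Spec R₀` — the rank hypothesis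
`hrank` making `Fix ε₀` a Barsotti–Tate group of height `h₀` over `R₀` (★ `fixedPart`), in particular on the SPECIAL fibre.
[cite: Tate1967, §2 (2.1) and (2.4)] [cite: GortzWedhorn2023, Prop. 27.188 (1)] [cite: Matsumura1987, Thm. 7.10] -/
theorem hrank_of_natCard_fixedPoints_of_isOfAbelianScheme {R₀ : Type u} [CommRing R₀] [IsLocalRing R₀]
    {A : AbelianSchemeOver (Spec (.of R₀))} {B₀ : BTGroup (Spec (.of R₀)) p h} (hB₀ : B₀.IsOfAbelianScheme A)
    (ε₀ : Hom B₀ B₀) (hε₀ : ∀ n, ε₀.app n ≫ ε₀.app n = ε₀.app n) {Ω : Type u} [Field Ω] [IsAlgClosed Ω]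
    (gΩ : Spec (.of Ω) ⟶ Spec (.of R₀)) (hpΩ : (p : Ω) ≠ 0) {h₀ : ℕ}
    (hcount : ∀ n, Nat.card {x : 𝟙_ (Over (Spec (.of Ω))) ⟶ (Over.pullback gΩ).obj (B₀.G n) //
      x ≫ (Over.pullback gΩ).map (ε₀.app n) = x} = p ^ (n * h₀))
    (n : ℕ) (s : ↥(Spec (.of R₀))) : (ε₀.fixLayer n).hom.finrank s = p ^ (n * h₀) :=
  hrank_of_natCard_points_of_etale ε₀ hε₀ gΩ (etale_fixLayer_baseChange_of_isOfAbelianScheme hB₀ ε₀ gΩ hpΩ)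
    (fun m => by rw [natCard_points_fixLayer_baseChange_eq]; exact hcount m) n s

/-- **BLOCK HEIGHT FROM THE GENERIC FIBRE for `A.pDivisibleGroup`.**  The previous theorem for the tree's chosen `p`-divisible
group `B₀ := A.pDivisibleGroup hp hg` (layers `A[pⁿ] = A.torsion (p ^ n)`, ★ `isOfAbelianScheme_pDivisibleGroup`): a count
`#{x ∈ (A[pⁿ] ×_{R₀} Ω)(Ω) | x ≫ (ε₀,ₙ ×_{R₀} Ω) = x} = p^{n h₀}` at a geometric point with `(p : Ω) ≠ 0` gives `hrank` with
height `h₀` for the idempotent `ε₀` on all of `Spec R₀`. [cite: Tate1967, §2 (2.1) and (2.4)] [cite: GortzWedhorn2023, Prop. 27.188 (1)]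
[cite: Matsumura1987, Thm. 7.10] -/
theorem hrank_pDivisibleGroup_of_natCard_fixedPoints {R₀ : Type u} [CommRing R₀] [IsLocalRing R₀]
    (A : AbelianSchemeOver (Spec (.of R₀))) [IsCommMonObj A.X] {g : ℕ} (hp : p ≠ 0) (hg : A.IsOfRelDim g)
    (ε₀ : Hom (A.pDivisibleGroup hp hg) (A.pDivisibleGroup hp hg)) (hε₀ : ∀ n, ε₀.app n ≫ ε₀.app n = ε₀.app n)
    {Ω : Type u} [Field Ω] [IsAlgClosed Ω] (gΩ : Spec (.of Ω) ⟶ Spec (.of R₀)) (hpΩ : (p : Ω) ≠ 0) {h₀ : ℕ}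
    (hcount : ∀ n, Nat.card {x : 𝟙_ (Over (Spec (.of Ω))) ⟶ (Over.pullback gΩ).obj (A.torsion (p ^ n)) //
      x ≫ (Over.pullback gΩ).map (ε₀.app n) = x} = p ^ (n * h₀))
    (n : ℕ) (s : ↥(Spec (.of R₀))) : (ε₀.fixLayer n).hom.finrank s = p ^ (n * h₀) :=
  hrank_of_natCard_fixedPoints_of_isOfAbelianScheme (A.isOfAbelianScheme_pDivisibleGroup hp hg) ε₀ hε₀ gΩ hpΩ hcount n s

end Hom

end BTGroup

end Literature.AlgebraicGeometry.GroupSchemes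

end
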